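import Mathlib.Probability.Kernel.Composition.MeasureCompProd
import Mathlib.Probability.Kernel.Composition.IntegralCompProd
import Mathlib.Probability.Kernel.Disintegration.StandardBorel
import Mathlib.MeasureTheory.Measure.Decomposition.RadonNikodym
import Literature.MathematicalPhysics.QuantumFieldTheory.Balaban1983to89.T4LipschitzLedger

/-!
# `Balaban1983to89.T4TermReprCoupling` — THE COMMON SPACE OF A MATCHED TERM PAIR under design (η): the input triple
# of the Lipschitz ledger (`TermRepr` of run A, `TermRepr` of run B on the SAME reference measure, (F∞) `SupClose`)
# CONSTRUCTED from PER-RUN data — run A on its own block-spin tower `(Ω_A, μ_A)`, run B on `Ω_A × Ω_F` against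
# `μ_A ⊗ₘ fib` (its extra, finest integration as a fibre kernel) — in two designs: (Π) run A lifted along the common
# coordinates, (F) run B fibre-integrated onto run A's tower; plus the left-density bridge
(cell `pub-balaban`, T4-DAG v20 §2 node U5b / §5 design row T4-U5b.E2 (design (η), Lipschitz cut-offs); journal row
`T4-U5b.E2-ETA-INSTANTIATION°`, surge seat pv07 gen 16 = the OWNER lineage of `T4IndicatorShell` / `T4LipschitzLedger` /
`T4LipschitzLedgerSocket`; record `t4/T4-EST-U5bE2.md` §12–§13; kernel module = [folklore] measure theory over Mathlib's
`MeasureTheory.Measure.compProd`; v1 p188285 `01277afdfdac`; v1.1 = v1 + §6 THE DISINTEGRATION CONSTRUCTOR — the same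
seat and generation; §§1–5 byte-identical to v1, two Mathlib imports added)

HONEST FRAMING (T4-DAG PAGE 1).  The cell's T4 target is the existence AND uniqueness of the continuum (`ε = L^{-K} → 0`)
limit of Bałaban's unit-scale expectations on a FIXED FINITE TORUS (`Missing.HasContinuumLimit`, rung (B)+1) — strictly
beyond ultraviolet stability ([Balaban1989LargeFieldII] Thm 1 p. 355); it is FINITE VOLUME, asserts NO mass gap, is NOT
the Yang–Mills Millennium problem and NOT the Clay problem.  Every use of the cell's spine is CONDITIONAL on the named
hypotheses `BetaPertH`, `(B)`, `(B^μ)`; none of them occurs below, even as a binder.  This module ASSERTS NOTHING about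
Bałaban's renormalization group: it is Fubini bookkeeping for the composition-product `μ ⊗ₘ κ` of a measure with a
kernel, typed so that it produces EXACTLY the hypothesis shapes `T4LipschitzLedger.TermRepr` / `SupClose` /
`T4LipschitzCutoff.SiblingSuppression (sibW …)` consumed by `T4LipschitzLedger.cauchy_of_repr` and
`T4LipschitzLedgerSocket.hybridNE7_of_repr`.  Value = kernel-checked bookkeeping + an explicit BINDER LIST for the seat
that instantiates `TermRepr` on the printed terms; NOT an estimate, NOT summit progress.

CITATION HEADER (lean-in-tree rule 2026-08-18).  NO statement of the audited series [Balaban1985Averaging] –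
[Balaban1989LargeFieldII] is asserted, quoted as a hypothesis, or used below; the manuscripts are the object of the
audit and are NOT cited for any step (cell ABSOLUTE RULE).  Nothing is cited at all: every theorem is proved in the
kernel from Mathlib (`MeasureTheory.Measure.fst_compProd`, `Measure.integral_compProd`, `Measure.ae_compProd_of_ae_ae`,
`Measure.ae_ae_of_ae_compProd`, `Integrable.integral_compProd`, `integral_map`, `integrable_map_measure`,
`lintegral_withDensity_eq_lintegral_mul`, `integral_withDensity_eq_integral_smul`).  The one printed sentence this module
is DESIGNED AROUND is carried VERBATIM, for SHAPE only, by the certified header of `T4LipschitzLedger` (this lineage,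
render `b2b-balaban-ref1/pages/1988-cmp119-convergent-renormalization/…-p015-x2.png`, journal p. 257 of
[Balaban1988Convergent] = cell paper B14, certificate `HOME/b2b-balaban-pv07/xread-T4LipschitzCutoff/…`): of the
terms of (2.18), *"Basically this operation is a composition of integrations restricted to large field regions in
successive scales, and multiplications by characteristic functions, δ-functions defining renormalization
transformations,"* — a term is an ITERATED integral.  `TermRepr` reads a term as ONE Bochner integral against a
reference measure `μ K τ`; this module is the dictionary between the two readings for a PAIR of runs.

## THE POINT (record `t4/T4-EST-U5bE2.md` §6.6 / §9.4 / §11.7: «the instantiation of `TermRepr` … under R-η-1…R-η-4′»)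

`T4LipschitzLedger.TermRepr`'s docstring says of the second family of tested variables: *«`uY K τ i` (the other run, on
the same space — the coupling of node U5a)»*, and `cauchy_of_repr` takes `hA : TermRepr … μ … uA uB RA` and
`hB : TermRepr … μ … uB uA RB` on ONE family of reference measures `μ K τ` with the remainder sandwich `hsw` stated
`μ K τ`-a.e.  Nothing in the tree so far SAYS what that common space is for two runs of different depth (run A: `K`
steps from `ε = L^{-K}`; run B: `K + 1` steps from `ε/L`; `T4SyncThresholds` is the threshold ARITHMETIC of node U5a and
carries no measure; `T4CouplingChain` / `T4PathwiseCoupling` couple the dressed and the undressed tower of ONE run for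
NE1′; `T4MaximalCoupling` couples two unit-scale LAWS).  The modelling dictionary (cell bookkeeping, NOT print): run B's
block-spin tower is run A's tower (the COMMON COORDINATES `v ∈ Ω_A(K,τ)`: every lattice field of run B except its finest
one lives on a lattice of run A) TIMES one extra, finest integration `w ∈ Ω_F(K,τ)`, performed FIRST in print's
composition; as measures, run B's reference on `Ω_A × Ω_F` is `μ_A ⊗ₘ fib` for a kernel `fib(K,τ) : Ω_A → Measure Ω_F`
(the law of the finest field given its block averages), up to a DENSITY of the common coordinates (the law of the
averaged finest field is not run A's bare reference but absolutely continuous with respect to it — cf. the tree's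
`HaarAC` statements `BlockAveragingEMLFibreLawSUN.haarAC_avgFun_expMeanLogSU_SUN` for the printed averages on `SU(N)`),
which §4 moves into run B's remainder.  On that dictionary this module PROVES ([folklore], every line):

* §1 GENERIC.  For `μ ⊗ₘ κ` with `κ` MARKOV: functions of the first coordinate keep their a.e. properties, integrability
  and integral (`ae_fst_of_ae`, `integrable_fst_iff`, `integral_fst`; via `Measure.fst_compProd`); for `κ` s-finite: fibre
  integration `v ↦ ∫ f(v,w) κ(v,dw)` preserves integrability and a.e. nonnegativity (`integrable_fibre`, `fibre_nonneg`), a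
  factor depending on `v` only comes out of the fibre integral (`integral_compProd_mul_fst`), and a LEFT DENSITY passes
  through: `(μ.withDensity h) ⊗ₘ κ = (μ ⊗ₘ κ).withDensity (h ∘ fst)` (`withDensity_compProd_left`).
* §2 DESIGN (Π) — THE PRODUCT COUPLING.  Reference `cpl μA fib K τ = μ_A(K,τ) ⊗ₘ fib(K,τ)` on `Ω_A × Ω_F`.  Run A's
  representation on its own tower LIFTS along the first projection (`termRepr_prodLift`, `fib` Markov); run B's
  representation on the coupled space is READ OFF its iterated form «∫ dμ_A(v) ∫ fib(v,dw) (∏ profile factors)·R^B»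
  (`termRepr_cpl_of_iterated` — the kernel form of print's «composition of integrations» for the pair); (F∞) on the
  coupled space from a fibrewise closeness statement (`supClose_cpl_of_fibrewise`) or from closeness of two families of
  the common coordinates (`supClose_cpl_of_fst`); run A's realized sibling weights — the quantities NE7c budgets — are
  THE SAME on the coupled space as on its own tower (`sibW_prodLift`), so its `SiblingSuppression` transfers verbatim
  (`siblingSuppression_prodLift`); END TO END `cauchy_of_cpl` = `T4LipschitzLedger.cauchy_of_repr` fed this way.
* §3 DESIGN (F) — FIBRE INTEGRATION (the natural design under rule R-η-3).  When run B's SLOT variables are functions of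
  the common coordinates (`liftU uB'`) — which is the case for every slot of the YOUNG window: a slot of age `a ≤ K`
  (`TermRepr.slot_band`) sits at run B's level `K + 1 − a ≥ 1`, a lattice of run A; only run B's finest level (age
  `K + 1`, never a slot) reads `w` — run B is represented ON RUN A's OWN TOWER `(Ω_A, μ_A)` with the FIBRE-INTEGRATED
  remainder `fibR fib RB K t τ v = ∫ R^B(K,t,τ)(v,w) fib(v,dw)` (`termRepr_fibre_of_cpl`); its realized sibling weights
  in that form equal those on its full tower (`sibW_fibre`, `siblingSuppression_fibre`); END TO END `cauchy_of_fibre`: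
  run A verbatim, run B on its full tower, (F∞) on the common coordinates, and the remainder sandwich between `R^A(v)`
  and the fibre-integrated `R^B` — integrating out run B's extra fluctuation field BEFORE comparing is exactly the
  renormalization-group reading of the comparison, and no product space survives in the hypotheses.
* §4 THE LEFT-DENSITY BRIDGE.  A representation against `ν.withDensity h` (a measurable `ℝ≥0`-valued density of the
  reference) is a representation against `ν` with remainder `h·R` (`termRepr_of_withDensity`); composed with §1,
  run B represented on its own tower `cpl (μ_A.withDensity h_d) fib` — common coordinates distributed with density `h_d`
  relative to run A's reference — is represented on `cpl μA fib` with remainder `h_d(v)·R^B(v,w)`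
  (`termRepr_cpl_of_commonDensity`), after which §2 / §3 apply.

* §6 (v1.1) THE DISINTEGRATION CONSTRUCTOR.  The fibre kernel and the density of the dictionary need NOT be built
  by hand.  For ANY family of FINITE references `ρ K τ` of run B on `Ω_A × Ω_F` with STANDARD BOREL fibres whose
  common-coordinate marginals are absolutely continuous w.r.t. run A's σ-finite references, `(ρ K τ).fst ≪ μ_A K τ`,
  Mathlib's disintegration (`Measure.condKernel`, `Measure.disintegrate : ρ.fst ⊗ₘ ρ.condKernel = ρ`) and Radon–Nikodym
  (`Measure.withDensity_rnDeriv_eq`, `Measure.rnDeriv_lt_top`) give `ρ K τ = (μ_A.withDensity (hdOf ρ μA K τ)) ⊗ₘ fibOf ρ K τ`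
  with `fibOf ρ K τ = (ρ K τ).condKernel` (MARKOV) and `hdOf ρ μA K τ = rnNN (ρ K τ).fst (μA K τ)` (the `ℝ≥0`-truncated
  Radon–Nikodym derivative; `withDensity_rnNN_eq`, `withDensity_compProd_condKernel`), hence
  `termRepr_cpl_of_disintegration`: run B represented against `ρ` is represented against `cpl μA (fibOf ρ)` with
  remainder `hdOf ρ μA (v) · R^B(v,w)` — after which §2 / §3 apply unchanged; `fst_cpl_withDensity_absolutelyContinuous`
  records that the absolute continuity is automatic for references already of the form `(μ_A.withDensity h) ⊗ₘ κ`, `κ`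
  Markov; `Sanity.termRepr_A_disintegrated` fires the constructor on the toy of §5 (fibre `Unit`).  CONSEQUENCE for the
  owed list (record §13.5): of the quadruple `(Ω_A, μ_A, fib, h_d)` the last two are OUTPUTS once run B's reference is
  GIVEN IN PRODUCT FORM `ρ K τ` on `Ω_A(K,τ) × Ω_F(K,τ)` (common coordinates × finest field), finite, standard Borel in
  the fibre (compact Lie groups and finite products of them are), with `ρ.fst ≪ μ_A` (for Haar block averages: the
  tree's `BlockAveraging…HaarAC` absolute-continuity statements, by name, are of this kind); what stays owed there is
  the product STRUCTURE itself and `μ_A` — typing, not estimates.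

WHAT THIS MODULE DOES NOT DO (OWED by the instantiating seat; record §13).  It does not construct `Ω_A`, `μ_A`, `fib`,
`h_d` for Bałaban's terms (the gauge-field tower, the averaging constraints as a disintegration — Mathlib's
`Measure.condKernel` gives `ρ = ρ.fst ⊗ₘ ρ.condKernel` for finite `ρ` and standard Borel fibres — and the density of the
averaged finest Haar field); it does not decide which printed factors are slots (the censuses `t4/T4-XREAD-U5X14/15/16.md`
and rules R-η-1…R-η-4′ do); it proves no estimate: (F∞) `SupClose`, `SiblingSuppression`, the remainder sandwich and
NE7b's `RelWeightBound` stay BINDERS, exactly as in `T4LipschitzLedger`.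

DISPLAY CONVENTION: none needed (no `K`-uniformity constant is produced here).
-/

open Finset MeasureTheory ProbabilityTheory _root_.Filter _root_.Topology
open scoped ENNReal NNReal

namespace Literature.MathematicalPhysics.QuantumFieldTheory.Balaban1983to89.T4TermReprCoupling

open T4IndicatorShell T4LipschitzCutoff T4WeightBudget T4HybridMatching T4CauchySum T4LipschitzLedger

noncomputable section

/-! ## §1 Generic [folklore] lemmas on `μ ⊗ₘ κ`: the common coordinates, fibre integration, a left density -/

section Generic

variable {α β : Type*} [MeasurableSpace α] [MeasurableSpace β] {μ : Measure α} {κ : Kernel α β}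

/-- With a MARKOV fibre kernel the common-coordinate marginal of `μ ⊗ₘ κ` is `μ` (`Measure.fst_compProd`, written as a
push-forward). [folklore] -/
theorem map_fst_compProd [SFinite μ] [IsMarkovKernel κ] : (μ ⊗ₘ κ).map Prod.fst = μ :=
  Measure.fst_compProd μ κ

/-- An almost-everywhere property of the common coordinates holds almost everywhere on the coupled space (no
measurability of the event is needed: `ae_of_ae_map`). [folklore] -/
theorem ae_fst_of_ae [SFinite μ] [IsMarkovKernel κ] {p : α → Prop} (h : ∀ᵐ v ∂μ, p v) :
    ∀ᵐ z ∂(μ ⊗ₘ κ), p z.1 :=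
  ae_of_ae_map measurable_fst.aemeasurable (by rw [map_fst_compProd]; exact h)

/-- a.e.-strong measurability of a function of the common coordinates lifts to the coupled space. [folklore] -/
theorem aestronglyMeasurable_fst [SFinite μ] [IsMarkovKernel κ] {E : Type*} [TopologicalSpace E] {f : α → E}
    (hf : AEStronglyMeasurable f μ) : AEStronglyMeasurable (fun z : α × β => f z.1) (μ ⊗ₘ κ) :=
  (by rw [map_fst_compProd]; exact hf : AEStronglyMeasurable f ((μ ⊗ₘ κ).map Prod.fst)).comp_measurable
    measurable_fst

/-- Integrability of a function of the common coordinates on the coupled space is its integrability on the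
common-coordinate space. [folklore] -/
theorem integrable_fst_iff [SFinite μ] [IsMarkovKernel κ] {E : Type*} [NormedAddCommGroup E] {f : α → E}
    (hf : AEStronglyMeasurable f μ) : Integrable (fun z : α × β => f z.1) (μ ⊗ₘ κ) ↔ Integrable f μ := by
  have h := integrable_map_measure (μ := μ ⊗ₘ κ) (f := Prod.fst) (g := f)
    (by rw [map_fst_compProd]; exact hf) measurable_fst.aemeasurable
  rw [map_fst_compProd] at h
  exact h.symm

/-- … and the integrals agree: `∫ f(z.1) d(μ ⊗ₘ κ) = ∫ f dμ`. [folklore] -/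
theorem integral_fst [SFinite μ] [IsMarkovKernel κ] {E : Type*} [NormedAddCommGroup E] [NormedSpace ℝ E]
    {f : α → E} (hf : AEStronglyMeasurable f μ) : ∫ z, f z.1 ∂(μ ⊗ₘ κ) = ∫ v, f v ∂μ := by
  have h := integral_map (μ := μ ⊗ₘ κ) (f := f) measurable_fst.aemeasurable
    (by rw [map_fst_compProd]; exact hf)
  rw [map_fst_compProd] at h
  exact h.symm

/-- FIBRE INTEGRATION preserves integrability (`Integrable.integral_compProd` in measure form). [folklore] -/
theorem integrable_fibre [SFinite μ] [IsSFiniteKernel κ] {E : Type*} [NormedAddCommGroup E] [NormedSpace ℝ E]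
    {f : α × β → E} (hf : Integrable f (μ ⊗ₘ κ)) : Integrable (fun v => ∫ w, f (v, w) ∂(κ v)) μ := by
  have h := hf
  rw [Measure.compProd] at h
  simpa using h.integral_compProd

/-- FIBRE INTEGRATION preserves almost-everywhere nonnegativity. [folklore] -/
theorem fibre_nonneg [SFinite μ] [IsSFiniteKernel κ] {f : α × β → ℝ} (hf : 0 ≤ᵐ[μ ⊗ₘ κ] f) :
    0 ≤ᵐ[μ] fun v => ∫ w, f (v, w) ∂(κ v) := by
  filter_upwards [Measure.ae_ae_of_ae_compProd hf] with v hv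
  refine integral_nonneg_of_ae ?_
  filter_upwards [hv] with w hw
  simpa using hw

/-- A factor depending on the common coordinates only comes OUT of the fibre integral:
`∫ g(z.1)·f(z) d(μ ⊗ₘ κ) = ∫ g(v)·(∫ f(v,w) κ(v,dw)) dμ(v)`. [folklore] -/
theorem integral_compProd_mul_fst [SFinite μ] [IsSFiniteKernel κ] {g : α → ℝ} {f : α × β → ℝ}
    (h : Integrable (fun z : α × β => g z.1 * f z) (μ ⊗ₘ κ)) :
    ∫ z, g z.1 * f z ∂(μ ⊗ₘ κ) = ∫ v, g v * ∫ w, f (v, w) ∂(κ v) ∂μ := by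
  rw [Measure.integral_compProd h]
  refine integral_congr_ae (ae_of_all _ fun v => ?_)
  exact integral_const_mul (g v) fun w => f (v, w)

/-- A LEFT DENSITY PASSES THROUGH THE COUPLING: `(μ.withDensity h) ⊗ₘ κ = (μ ⊗ₘ κ).withDensity (h ∘ fst)` for a
measurable `h` and an s-finite `κ` (both sides give `∫⁻ h(a)·κ(a)(s_a) dμ(a)` to a measurable `s`). [folklore] -/
theorem withDensity_compProd_left [SFinite μ] [IsSFiniteKernel κ] {h : α → ℝ≥0∞} (hh : Measurable h) :
    (μ.withDensity h) ⊗ₘ κ = (μ ⊗ₘ κ).withDensity (fun z => h z.1) := by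
  ext s hs
  have hL : ((μ.withDensity h) ⊗ₘ κ) s = ∫⁻ a, h a * κ a (Prod.mk a ⁻¹' s) ∂μ := by
    rw [Measure.compProd_apply hs,
      lintegral_withDensity_eq_lintegral_mul μ hh (Kernel.measurable_kernel_prodMk_left hs)]
    rfl
  have hR : ((μ ⊗ₘ κ).withDensity fun z => h z.1) s = ∫⁻ a, h a * κ a (Prod.mk a ⁻¹' s) ∂μ := by
    rw [withDensity_apply _ hs, ← lintegral_indicator hs,
      Measure.lintegral_compProd (f := s.indicator fun z : α × β => h z.1) ((hh.comp measurable_fst).indicator hs)]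
    refine lintegral_congr fun a => ?_
    have hind : ∀ b, s.indicator (fun z : α × β => h z.1) (a, b) = h a * (Prod.mk a ⁻¹' s).indicator 1 b := by
      intro b
      by_cases hb : (a, b) ∈ s
      · simp [Set.indicator_of_mem hb, Set.indicator_of_mem (show b ∈ Prod.mk a ⁻¹' s from hb)]
      · simp [Set.indicator_of_notMem hb, Set.indicator_of_notMem (show b ∉ Prod.mk a ⁻¹' s from hb)]
    simp_rw [hind]
    rw [lintegral_const_mul _ (measurable_one.indicator (measurable_prodMk_left hs)),
      lintegral_indicator_one (measurable_prodMk_left hs)]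
  rw [hL, hR]

end Generic

/-! ## §2 DESIGN (Π): the coupled space `Ω_A × Ω_F`, reference `μ_A ⊗ₘ fib`; run A lifted along the common coordinates -/

section Coupled

variable {ι : Type*} {ΩA ΩF : ℕ → ι → Type*} [∀ K τ, MeasurableSpace (ΩA K τ)] [∀ K τ, MeasurableSpace (ΩF K τ)]

/-- THE COUPLED REFERENCE MEASURES `μ_A(K,τ) ⊗ₘ fib(K,τ)` on `Ω_A(K,τ) × Ω_F(K,τ)`: run A's tower measure composed with
the fibre kernel of run B's extra (finest) integration. [folklore] -/
abbrev cpl (μA : (K : ℕ) → (τ : ι) → Measure (ΩA K τ)) (fib : (K : ℕ) → (τ : ι) → Kernel (ΩA K τ) (ΩF K τ)) :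
    (K : ℕ) → (τ : ι) → Measure (ΩA K τ × ΩF K τ) :=
  fun K τ => μA K τ ⊗ₘ fib K τ

/-- a family of tested variables of the common coordinates, read on the coupled space. [folklore] -/
abbrev liftU (u : (K : ℕ) → (τ : ι) → ℕ → ΩA K τ → ℝ) : (K : ℕ) → (τ : ι) → ℕ → ΩA K τ × ΩF K τ → ℝ :=
  fun K τ i z => u K τ i z.1

/-- a remainder of the common coordinates, read on the coupled space. [folklore] -/
abbrev liftR (R : (K : ℕ) → ℝ → (τ : ι) → ΩA K τ → ℝ) : (K : ℕ) → ℝ → (τ : ι) → ΩA K τ × ΩF K τ → ℝ :=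
  fun K t τ z => R K t τ z.1

/-- THE FIBRE-INTEGRATED REMAINDER of run B: `v ↦ ∫ R^B(K,t,τ)(v, w) fib(K,τ)(v, dw)`. [folklore] -/
def fibR (fib : (K : ℕ) → (τ : ι) → Kernel (ΩA K τ) (ΩF K τ))
    (RB : (K : ℕ) → ℝ → (τ : ι) → ΩA K τ × ΩF K τ → ℝ) : (K : ℕ) → ℝ → (τ : ι) → ΩA K τ → ℝ :=
  fun K t τ v => ∫ w, RB K t τ (v, w) ∂(fib K τ v)

variable {l₀ vol : ℝ} {T : ℕ → Finset ι} {A B : ℕ → ℝ → ι → ℝ} {χ : ℕ → ℝ → ℝ} {κ Lχ : ℕ → ℝ} {N : ℕ} {n : ℕ → ℕ}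
  {μA : (K : ℕ) → (τ : ι) → Measure (ΩA K τ)} {fib : (K : ℕ) → (τ : ι) → Kernel (ΩA K τ) (ΩF K τ)}
  {m : ℕ → ι → ℕ} {slot : ℕ → ι → ℕ → Σ _ : ℕ, ℕ} {pol : ℕ → ι → ℕ → Pol} {θ : ℕ → ι → ℕ → ℝ}
  {uA uB' uY : (K : ℕ) → (τ : ι) → ℕ → ΩA K τ → ℝ} {RA : (K : ℕ) → ℝ → (τ : ι) → ΩA K τ → ℝ}
  {uB uZ : (K : ℕ) → (τ : ι) → ℕ → ΩA K τ × ΩF K τ → ℝ} {RB : (K : ℕ) → ℝ → (τ : ι) → ΩA K τ × ΩF K τ → ℝ}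
  {ρ S W δ : ℕ → ℝ} {Bad : ℕ → ℝ → Finset ι} {Z : ℕ → ℝ → ℝ}

/-- **RUN A LIFTED.**  A run represented on its own tower `(Ω_A, μ_A)` is represented on the coupled space against
`μ_A ⊗ₘ fib` (`fib` MARKOV) with its tested variables and remainder read through the first projection and ANY measurable
family `uB` as the other run's variables: the profile / threshold / slot fields are inherited, measurability composes with
`fst`, and the remainder's a.e. nonnegativity, its integrability and the representation integral pass along `fst` (§1).
[folklore] -/
theorem termRepr_prodLift [∀ K τ, SFinite (μA K τ)] [∀ K τ, IsMarkovKernel (fib K τ)]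
    (hA : TermRepr l₀ T A χ κ Lχ N n μA m slot pol θ uA uY RA)
    (hB : ∀ K, ∀ τ ∈ T K, ∀ i < m K τ, Measurable (uB K τ i)) :
    TermRepr l₀ T A χ κ Lχ N n (cpl μA fib) m slot pol θ (liftU uA) uB (liftR RA) where
  profile := hA.profile
  thr_pos := hA.thr_pos
  slot_mem := hA.slot_mem
  slot_band := hA.slot_band
  meas K τ hτ i hi := ⟨(hA.meas K τ hτ i hi).1.comp measurable_fst, hB K τ hτ i hi⟩
  rem_nonneg K t ht τ hτ := by
    filter_upwards [ae_fst_of_ae (κ := fib K τ) (hA.rem_nonneg K t ht τ hτ)] with z hz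
    simpa using hz
  rem_int K t ht τ hτ :=
    (integrable_fst_iff (hA.rem_int K t ht τ hτ).aestronglyMeasurable).2 (hA.rem_int K t ht τ hτ)
  repr K t ht τ hτ := by
    rw [hA.repr K t ht τ hτ]
    exact (integral_fst (κ := fib K τ) (hA.integrable_prod ht hτ).aestronglyMeasurable).symm

/-- **RUN B ON THE COUPLED SPACE FROM ITS ITERATED FORM** (print's «composition of integrations» for the pair, the extra
finest integration performed first): the structural fields, joint measurability of both families of tested variables,
an a.e.-nonnegative remainder integrable against `μ_A ⊗ₘ fib`, and the term weight given as the ITERATED integral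
`∫ dμ_A(v) ∫ fib(v,dw) (∏ profile slot factors)(v,w)·R^B(v,w)` ⇒ `TermRepr` against `μ_A ⊗ₘ fib` (Fubini,
`Measure.integral_compProd`; `fib` s-finite suffices). [folklore] -/
theorem termRepr_cpl_of_iterated [∀ K τ, SFinite (μA K τ)] [∀ K τ, IsSFiniteKernel (fib K τ)]
    (hprof : ∀ a, LipProfile (χ a) (κ a) (Lχ a)) (hthr : ∀ K, ∀ τ ∈ T K, ∀ i < m K τ, 0 < θ K τ i)
    (hmem : ∀ K, ∀ τ ∈ T K, ∀ i < m K τ, slot K τ i ∈ (range (N + 1)).sigma fun a => range (n a))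
    (hband : ∀ K, ∀ τ ∈ T K, ∀ i < m K τ, (slot K τ i).1 ≤ K)
    (hmB : ∀ K, ∀ τ ∈ T K, ∀ i < m K τ, Measurable (uB K τ i))
    (hmZ : ∀ K, ∀ τ ∈ T K, ∀ i < m K τ, Measurable (uZ K τ i))
    (h0 : ∀ K t, |t| ≤ l₀ → ∀ τ ∈ T K, 0 ≤ᵐ[cpl μA fib K τ] RB K t τ)
    (hint : ∀ K t, |t| ≤ l₀ → ∀ τ ∈ T K, Integrable (RB K t τ) (cpl μA fib K τ))
    (hrepr : ∀ K t, |t| ≤ l₀ → ∀ τ ∈ T K, B K t τ = ∫ v, ∫ w,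
      (∏ i ∈ range (m K τ), facAt χ (slot K τ) (pol K τ) (θ K τ) (fun j => uB K τ j (v, w)) i) * RB K t τ (v, w)
        ∂(fib K τ v) ∂(μA K τ)) :
    TermRepr l₀ T B χ κ Lχ N n (cpl μA fib) m slot pol θ uB uZ RB where
  profile := hprof
  thr_pos := hthr
  slot_mem := hmem
  slot_band := hband
  meas K τ hτ i hi := ⟨hmB K τ hτ i hi, hmZ K τ hτ i hi⟩
  rem_nonneg := h0
  rem_int := hint
  repr K t ht τ hτ := by
    rw [hrepr K t ht τ hτ, Measure.integral_compProd]
    exact integrable_unitInterval_mul (hint K t ht τ hτ)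
      (Finset.measurable_prod _ fun i hi => measurable_facAt hprof (hmB K τ hτ i (mem_range.1 hi)))
      (fun _ => prod_nonneg fun i _ => facAt_nonneg hprof i) fun _ => prod_facAt_le_one hprof

/-- **THE ITERATED READING OF A REPRESENTED TERM** (converse direction): a run represented against `μ_A ⊗ₘ fib` has its
term weights as the iterated integrals, finest fibre inside. [folklore] -/
theorem repr_iterated [∀ K τ, SFinite (μA K τ)] [∀ K τ, IsSFiniteKernel (fib K τ)]
    (hB : TermRepr l₀ T B χ κ Lχ N n (cpl μA fib) m slot pol θ uB uZ RB) {K : ℕ} {t : ℝ} (ht : |t| ≤ l₀) {τ : ι}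
    (hτ : τ ∈ T K) :
    B K t τ = ∫ v, ∫ w,
      (∏ i ∈ range (m K τ), facAt χ (slot K τ) (pol K τ) (θ K τ) (fun j => uB K τ j (v, w)) i) * RB K t τ (v, w)
        ∂(fib K τ v) ∂(μA K τ) := by
  rw [hB.repr K t ht τ hτ, Measure.integral_compProd (hB.integrable_prod ht hτ)]

/-- **(F∞) ON THE COUPLED SPACE FROM A FIBREWISE STATEMENT**: for measurable families `uB`, `uZ` on `Ω_A × Ω_F`, closeness
`μ_A`-a.e. in `v` and `fib(v)`-a.e. in `w` is closeness `μ_A ⊗ₘ fib`-a.e. (`Measure.ae_compProd_of_ae_ae`; the event is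
measurable). [folklore] -/
theorem supClose_cpl_of_fibrewise [∀ K τ, SFinite (μA K τ)] [∀ K τ, IsSFiniteKernel (fib K τ)]
    (hmB : ∀ K, ∀ τ ∈ T K, ∀ i < m K τ, Measurable (uB K τ i))
    (hmZ : ∀ K, ∀ τ ∈ T K, ∀ i < m K τ, Measurable (uZ K τ i))
    (h : ∀ K, ∀ τ ∈ T K, ∀ i < m K τ, ∀ᵐ v ∂(μA K τ), ∀ᵐ w ∂(fib K τ v),
      |uB K τ i (v, w) - uZ K τ i (v, w)| ≤ ρ (K - (slot K τ i).1) * θ K τ i) :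
    SupClose T (cpl μA fib) m slot θ uB uZ ρ := fun K τ hτ i hi =>
  Measure.ae_compProd_of_ae_ae
    (measurableSet_le (continuous_abs.measurable.comp ((hmB K τ hτ i hi).sub (hmZ K τ hτ i hi))) measurable_const)
    (h K τ hτ i hi)

/-- **(F∞) ON THE COUPLED SPACE FROM THE COMMON COORDINATES**: closeness of two families of the common coordinates
`μ_A`-a.e. is closeness of their lifts `μ_A ⊗ₘ fib`-a.e. (`fib` Markov; no measurability needed). [folklore] -/
theorem supClose_cpl_of_fst [∀ K τ, SFinite (μA K τ)] [∀ K τ, IsMarkovKernel (fib K τ)]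
    (h : SupClose T μA m slot θ uA uY ρ) : SupClose T (cpl μA fib) m slot θ (liftU uA) (liftU uY) ρ :=
  fun K τ hτ i hi =>
    ae_fst_of_ae (p := fun v => |uA K τ i v - uY K τ i v| ≤ ρ (K - (slot K τ i).1) * θ K τ i) (h K τ hτ i hi)

/-- **RUN A's REALIZED SIBLING WEIGHTS ARE THE SAME ON THE COUPLED SPACE** (the quantities `SiblingSuppression` budgets:
integrals of functions of the common coordinates; `fib` Markov), at every `|t| ≤ l₀`, `τ ∈ T K`, slot `σ`. [folklore] -/
theorem sibW_prodLift [∀ K τ, SFinite (μA K τ)] [∀ K τ, IsMarkovKernel (fib K τ)]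
    (hA : TermRepr l₀ T A χ κ Lχ N n μA m slot pol θ uA uY RA) {K : ℕ} {t : ℝ} (ht : |t| ≤ l₀) {τ : ι}
    (hτ : τ ∈ T K) (σ : Σ _ : ℕ, ℕ) :
    sibW χ κ (cpl μA fib) m slot pol θ (liftU uA) (liftR RA) ρ σ K t τ = sibW χ κ μA m slot pol θ uA RA ρ σ K t τ := by
  unfold sibW
  refine sum_congr rfl fun i hi => ?_
  have hi' : i < m K τ := mem_range.1 (mem_filter.1 hi).1
  exact integral_fst (κ := fib K τ) (hA.integrable_sib ht hτ hi' (ρ (K - (slot K τ i).1))).aestronglyMeasurable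

/-- … hence run A's `SiblingSuppression`, stated on its own tower, HOLDS VERBATIM on the coupled space. [folklore] -/
theorem siblingSuppression_prodLift [∀ K τ, SFinite (μA K τ)] [∀ K τ, IsMarkovKernel (fib K τ)]
    (hA : TermRepr l₀ T A χ κ Lχ N n μA m slot pol θ uA uY RA)
    (hS : SiblingSuppression l₀ T A N n (sibW χ κ μA m slot pol θ uA RA ρ) S) :
    SiblingSuppression l₀ T A N n (sibW χ κ (cpl μA fib) m slot pol θ (liftU uA) (liftR RA) ρ) S := by
  intro σ hσ K t ht
  rw [sum_congr rfl fun τ hτ => sibW_prodLift (fib := fib) (ρ := ρ) hA ht hτ σ]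
  exact hS σ hσ K t ht

/-- **END TO END IN DESIGN (Π)** (CONDITIONAL kernel theorem; every estimate a binder): run A represented on its own tower,
run B on the coupled space `μ_A ⊗ₘ fib` with the lift of run A's variables as the other family, (F∞) on the coupled
space, run A's sibling suppression ON ITS OWN TOWER and run B's on the coupled space, and the remainder sandwich between
the lifted `R^A` and `R^B` a.e. on the coupled space — then every conclusion of `T4LipschitzLedger.cauchy_of_repr`
(matching modulo constants, summable remainders, Cauchy generating functions, uniform convergence on `|t| ≤ l₀`).
Nothing of Bałaban's is asserted. [folklore] -/
theorem cauchy_of_cpl [DecidableEq ι] [∀ K τ, SFinite (μA K τ)] [∀ K τ, IsMarkovKernel (fib K τ)]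
    (hvol : 0 < vol) (hl₀ : 0 ≤ l₀) (hW : RelWeightBound l₀ T A B Bad W)
    (hA : TermRepr l₀ T A χ κ Lχ N n μA m slot pol θ uA uY RA)
    (hB : TermRepr l₀ T B χ κ Lχ N n (cpl μA fib) m slot pol θ uB (liftU uA) RB)
    (hF : SupClose T (cpl μA fib) m slot θ (liftU uA) uB ρ)
    (hSA : SiblingSuppression l₀ T A N n (sibW χ κ μA m slot pol θ uA RA ρ) S)
    (hSB : SiblingSuppression l₀ T B N n (sibW χ κ (cpl μA fib) m slot pol θ uB RB ρ) S)
    (hS : ∀ a ≤ N, 0 ≤ S a) (hρ0 : ∀ j, 0 ≤ ρ j) (hρ : Summable ρ)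
    (hlt : ∀ K, W K + ∑ a ∈ range (N + 1), (n a : ℝ) * lipWeight Lχ S ρ a K < 1)
    (hZA : ∀ K t, |t| ≤ l₀ → Z K t = ∑ τ ∈ T K, A K t τ)
    (hZB : ∀ K t, |t| ≤ l₀ → Z (K + 1) t = ∑ τ ∈ T K, B K t τ)
    (hpos : ∀ K t, |t| ≤ l₀ → 0 < ∑ τ ∈ T K, A K t τ) (hδ : Summable δ) {c : ℕ → ℝ}
    (hsw : ∀ K t, |t| ≤ l₀ → ∀ τ ∈ T K \ Bad K t,
      (∀ᵐ z ∂(cpl μA fib K τ), Real.exp (c K - vol * δ K) * RA K t τ z.1 ≤ RB K t τ z) ∧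
        (∀ᵐ z ∂(cpl μA fib K τ), RB K t τ z ≤ Real.exp (c K + vol * δ K) * RA K t τ z.1)) :
    MatchingModConstants vol l₀
        (hybridDelta vol δ (fun K => W K + ∑ a ∈ range (N + 1), (n a : ℝ) * lipWeight Lχ S ρ a K)) Z ∧
      Summable (hybridDelta vol δ (fun K => W K + ∑ a ∈ range (N + 1), (n a : ℝ) * lipWeight Lχ S ρ a K)) ∧
      (∀ t : ℝ, |t| ≤ l₀ → CauchySeq fun K => genFun Z K t) ∧
      TendstoUniformlyOn (fun K t => genFun Z K t) (genFunLim Z) atTop {t | |t| ≤ l₀} :=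
  cauchy_of_repr hvol hl₀ hW (termRepr_prodLift hA fun K τ hτ i hi => (hB.meas K τ hτ i hi).1) hB hF
    (siblingSuppression_prodLift hA hSA) hSB hS hρ0 hρ hlt hZA hZB hpos hδ hsw

/-! ## §3 DESIGN (F): run B fibre-integrated onto run A's tower (slot variables of the common coordinates) -/

/-- **RUN B FIBRE-INTEGRATED.**  A run represented on the coupled space `μ_A ⊗ₘ fib` whose slot variables `liftU uB'`
and other-run variables `liftU uA` are functions of the common coordinates, both families measurable on `Ω_A`, is
represented ON RUN A's OWN TOWER `(Ω_A, μ_A)` with the fibre-integrated remainder `fibR fib RB` (`fib` s-finite: the slot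
product comes out of the fibre integral, `integral_compProd_mul_fst`; nonnegativity and integrability of the new
remainder by `fibre_nonneg` / `integrable_fibre`). [folklore] -/
theorem termRepr_fibre_of_cpl [∀ K τ, SFinite (μA K τ)] [∀ K τ, IsSFiniteKernel (fib K τ)]
    (hB : TermRepr l₀ T B χ κ Lχ N n (cpl μA fib) m slot pol θ (liftU uB') (liftU uA) RB)
    (hmB : ∀ K, ∀ τ ∈ T K, ∀ i < m K τ, Measurable (uB' K τ i))
    (hmA : ∀ K, ∀ τ ∈ T K, ∀ i < m K τ, Measurable (uA K τ i)) :
    TermRepr l₀ T B χ κ Lχ N n μA m slot pol θ uB' uA (fibR fib RB) where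
  profile := hB.profile
  thr_pos := hB.thr_pos
  slot_mem := hB.slot_mem
  slot_band := hB.slot_band
  meas K τ hτ i hi := ⟨hmB K τ hτ i hi, hmA K τ hτ i hi⟩
  rem_nonneg K t ht τ hτ := fibre_nonneg (hB.rem_nonneg K t ht τ hτ)
  rem_int K t ht τ hτ := integrable_fibre (hB.rem_int K t ht τ hτ)
  repr K t ht τ hτ := by
    rw [hB.repr K t ht τ hτ]
    exact integral_compProd_mul_fst
      (g := fun v => ∏ i ∈ range (m K τ), facAt χ (slot K τ) (pol K τ) (θ K τ) (fun j => uB' K τ j v) i)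
      (f := RB K t τ) (hB.integrable_prod ht hτ)

/-- **RUN B's REALIZED SIBLING WEIGHTS IN FIBRE-INTEGRATED FORM EQUAL THOSE ON ITS FULL TOWER**, at every `|t| ≤ l₀`,
`τ ∈ T K`, slot `σ` (the sibling functions depend on the common coordinates only). [folklore] -/
theorem sibW_fibre [∀ K τ, SFinite (μA K τ)] [∀ K τ, IsSFiniteKernel (fib K τ)]
    (hB : TermRepr l₀ T B χ κ Lχ N n (cpl μA fib) m slot pol θ (liftU uB') uZ RB) {K : ℕ} {t : ℝ} (ht : |t| ≤ l₀)
    {τ : ι} (hτ : τ ∈ T K) (σ : Σ _ : ℕ, ℕ) :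
    sibW χ κ (cpl μA fib) m slot pol θ (liftU uB') RB ρ σ K t τ =
      sibW χ κ μA m slot pol θ uB' (fibR fib RB) ρ σ K t τ := by
  unfold sibW
  refine sum_congr rfl fun i hi => ?_
  have hi' : i < m K τ := mem_range.1 (mem_filter.1 hi).1
  exact integral_compProd_mul_fst
    (g := fun v => sibAt χ κ (slot K τ) (pol K τ) (θ K τ) (fun j => uB' K τ j v) (ρ (K - (slot K τ i).1)) (m K τ) i)
    (f := RB K t τ) (hB.integrable_sib ht hτ hi' (ρ (K - (slot K τ i).1)))

/-- … hence run B's `SiblingSuppression` on its full tower IS its `SiblingSuppression` in fibre-integrated form.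
[folklore] -/
theorem siblingSuppression_fibre [∀ K τ, SFinite (μA K τ)] [∀ K τ, IsSFiniteKernel (fib K τ)]
    (hB : TermRepr l₀ T B χ κ Lχ N n (cpl μA fib) m slot pol θ (liftU uB') uZ RB)
    (hS : SiblingSuppression l₀ T B N n (sibW χ κ (cpl μA fib) m slot pol θ (liftU uB') RB ρ) S) :
    SiblingSuppression l₀ T B N n (sibW χ κ μA m slot pol θ uB' (fibR fib RB) ρ) S := by
  intro σ hσ K t ht
  rw [← sum_congr rfl fun τ hτ => sibW_fibre (ρ := ρ) hB ht hτ σ]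
  exact hS σ hσ K t ht

/-- **END TO END IN DESIGN (F)** (CONDITIONAL kernel theorem; every estimate a binder; the natural form under rule
R-η-3).  Run A represented on its own tower with run B's common-coordinate slot variables `uB'` as the other family; run B
represented on its full tower `μ_A ⊗ₘ fib` with slot variables `liftU uB'`; (F∞) between `uA` and `uB'` ON THE COMMON
COORDINATES; run A's sibling suppression on its tower, run B's on its full tower; and the remainder sandwich between
`R^A(v)` and the FIBRE-INTEGRATED `R^B` (`fibR fib RB`) `μ_A`-a.e. on the good terms — then every conclusion of
`T4LipschitzLedger.cauchy_of_repr`.  No product space survives in the hypotheses' a.e. statements; nothing of Bałaban's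
is asserted. [folklore] -/
theorem cauchy_of_fibre [DecidableEq ι] [∀ K τ, SFinite (μA K τ)] [∀ K τ, IsSFiniteKernel (fib K τ)]
    (hvol : 0 < vol) (hl₀ : 0 ≤ l₀) (hW : RelWeightBound l₀ T A B Bad W)
    (hA : TermRepr l₀ T A χ κ Lχ N n μA m slot pol θ uA uB' RA)
    (hB : TermRepr l₀ T B χ κ Lχ N n (cpl μA fib) m slot pol θ (liftU uB') (liftU uA) RB)
    (hF : SupClose T μA m slot θ uA uB' ρ)
    (hSA : SiblingSuppression l₀ T A N n (sibW χ κ μA m slot pol θ uA RA ρ) S)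
    (hSB : SiblingSuppression l₀ T B N n (sibW χ κ (cpl μA fib) m slot pol θ (liftU uB') RB ρ) S)
    (hS : ∀ a ≤ N, 0 ≤ S a) (hρ0 : ∀ j, 0 ≤ ρ j) (hρ : Summable ρ)
    (hlt : ∀ K, W K + ∑ a ∈ range (N + 1), (n a : ℝ) * lipWeight Lχ S ρ a K < 1)
    (hZA : ∀ K t, |t| ≤ l₀ → Z K t = ∑ τ ∈ T K, A K t τ)
    (hZB : ∀ K t, |t| ≤ l₀ → Z (K + 1) t = ∑ τ ∈ T K, B K t τ)
    (hpos : ∀ K t, |t| ≤ l₀ → 0 < ∑ τ ∈ T K, A K t τ) (hδ : Summable δ) {c : ℕ → ℝ}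
    (hsw : ∀ K t, |t| ≤ l₀ → ∀ τ ∈ T K \ Bad K t,
      (∀ᵐ v ∂(μA K τ), Real.exp (c K - vol * δ K) * RA K t τ v ≤ fibR fib RB K t τ v) ∧
        (∀ᵐ v ∂(μA K τ), fibR fib RB K t τ v ≤ Real.exp (c K + vol * δ K) * RA K t τ v)) :
    MatchingModConstants vol l₀
        (hybridDelta vol δ (fun K => W K + ∑ a ∈ range (N + 1), (n a : ℝ) * lipWeight Lχ S ρ a K)) Z ∧
      Summable (hybridDelta vol δ (fun K => W K + ∑ a ∈ range (N + 1), (n a : ℝ) * lipWeight Lχ S ρ a K)) ∧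
      (∀ t : ℝ, |t| ≤ l₀ → CauchySeq fun K => genFun Z K t) ∧
      TendstoUniformlyOn (fun K t => genFun Z K t) (genFunLim Z) atTop {t | |t| ≤ l₀} :=
  cauchy_of_repr hvol hl₀ hW hA
    (termRepr_fibre_of_cpl hB (fun K τ hτ i hi => (hA.meas K τ hτ i hi).2) fun K τ hτ i hi => (hA.meas K τ hτ i hi).1)
    hF hSA (siblingSuppression_fibre hB hSB) hS hρ0 hρ hlt hZA hZB hpos hδ hsw

end Coupled

/-! ## §4 The left-density bridge: a density of the reference goes into the remainder -/

section Density

variable {ι : Type*} {Ω : ℕ → ι → Type*} [∀ K τ, MeasurableSpace (Ω K τ)]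
  {l₀ : ℝ} {T : ℕ → Finset ι} {B : ℕ → ℝ → ι → ℝ} {χ : ℕ → ℝ → ℝ} {κ Lχ : ℕ → ℝ} {N : ℕ} {n : ℕ → ℕ}
  {ν : (K : ℕ) → (τ : ι) → Measure (Ω K τ)} {hd : (K : ℕ) → (τ : ι) → Ω K τ → ℝ≥0}
  {m : ℕ → ι → ℕ} {slot : ℕ → ι → ℕ → Σ _ : ℕ, ℕ} {pol : ℕ → ι → ℕ → Pol} {θ : ℕ → ι → ℕ → ℝ}
  {uX uY : (K : ℕ) → (τ : ι) → ℕ → Ω K τ → ℝ} {RB : (K : ℕ) → ℝ → (τ : ι) → Ω K τ → ℝ}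

/-- **A DENSITY OF THE REFERENCE IS A FACTOR OF THE REMAINDER.**  A run represented against `ν.withDensity h_d` (a
measurable `ℝ≥0`-valued density) is represented against `ν` with the remainder `h_d · R` (`ae_withDensity_iff`,
`integrable_withDensity_iff_integrable_smul`, `integral_withDensity_eq_integral_smul`). [folklore] -/
theorem termRepr_of_withDensity
    (hB : TermRepr l₀ T B χ κ Lχ N n (fun K τ => (ν K τ).withDensity fun v => (hd K τ v : ℝ≥0∞)) m slot pol θ
      uX uY RB) (hhd : ∀ K τ, Measurable (hd K τ)) :
    TermRepr l₀ T B χ κ Lχ N n ν m slot pol θ uX uY (fun K t τ v => (hd K τ v : ℝ) * RB K t τ v) where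
  profile := hB.profile
  thr_pos := hB.thr_pos
  slot_mem := hB.slot_mem
  slot_band := hB.slot_band
  meas := hB.meas
  rem_nonneg K t ht τ hτ := by
    have h := (ae_withDensity_iff (measurable_coe_nnreal_ennreal.comp (hhd K τ))).1 (hB.rem_nonneg K t ht τ hτ)
    filter_upwards [h] with v hv
    by_cases h0 : hd K τ v = 0
    · simp [h0]
    · have : (0 : ℝ) ≤ RB K t τ v := by simpa using hv (by simpa using h0)
      exact mul_nonneg (hd K τ v).coe_nonneg this
  rem_int K t ht τ hτ := by
    have h := (integrable_withDensity_iff_integrable_smul (hhd K τ)).1 (hB.rem_int K t ht τ hτ)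
    simpa [NNReal.smul_def, smul_eq_mul] using h
  repr K t ht τ hτ := by
    rw [hB.repr K t ht τ hτ, integral_withDensity_eq_integral_smul (hhd K τ)]
    refine integral_congr_ae (ae_of_all _ fun v => ?_)
    simp only [NNReal.smul_def, smul_eq_mul]
    ring

end Density

section DensityCoupled

variable {ι : Type*} {ΩA ΩF : ℕ → ι → Type*} [∀ K τ, MeasurableSpace (ΩA K τ)] [∀ K τ, MeasurableSpace (ΩF K τ)]
  {l₀ : ℝ} {T : ℕ → Finset ι} {B : ℕ → ℝ → ι → ℝ} {χ : ℕ → ℝ → ℝ} {κ Lχ : ℕ → ℝ} {N : ℕ} {n : ℕ → ℕ}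
  {μA : (K : ℕ) → (τ : ι) → Measure (ΩA K τ)} {fib : (K : ℕ) → (τ : ι) → Kernel (ΩA K τ) (ΩF K τ)}
  {hd : (K : ℕ) → (τ : ι) → ΩA K τ → ℝ≥0}
  {m : ℕ → ι → ℕ} {slot : ℕ → ι → ℕ → Σ _ : ℕ, ℕ} {pol : ℕ → ι → ℕ → Pol} {θ : ℕ → ι → ℕ → ℝ}
  {uB uZ : (K : ℕ) → (τ : ι) → ℕ → ΩA K τ × ΩF K τ → ℝ} {RB : (K : ℕ) → ℝ → (τ : ι) → ΩA K τ × ΩF K τ → ℝ}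

/-- **RUN B ON ITS OWN TOWER ⇒ RUN B ON THE COUPLED SPACE.**  If run B is represented against
`(μ_A.withDensity h_d) ⊗ₘ fib` — its common coordinates distributed with a measurable `ℝ≥0` density `h_d` relative to
run A's reference, its finest field by the s-finite fibre kernel `fib` — then it is represented against `μ_A ⊗ₘ fib`
with remainder `h_d(v)·R^B(v,w)` (`withDensity_compProd_left` + `termRepr_of_withDensity`); §2 / §3 then apply.
[folklore] -/
theorem termRepr_cpl_of_commonDensity [∀ K τ, SFinite (μA K τ)] [∀ K τ, IsSFiniteKernel (fib K τ)]
    (hhd : ∀ K τ, Measurable (hd K τ))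
    (hB : TermRepr l₀ T B χ κ Lχ N n (cpl (fun K τ => (μA K τ).withDensity fun v => (hd K τ v : ℝ≥0∞)) fib)
      m slot pol θ uB uZ RB) :
    TermRepr l₀ T B χ κ Lχ N n (cpl μA fib) m slot pol θ uB uZ (fun K t τ z => (hd K τ z.1 : ℝ) * RB K t τ z) := by
  have hcpl : cpl (fun K τ => (μA K τ).withDensity fun v => (hd K τ v : ℝ≥0∞)) fib =
      fun K τ => (cpl μA fib K τ).withDensity fun z => (hd K τ z.1 : ℝ≥0∞) :=
    funext fun K => funext fun τ => withDensity_compProd_left (measurable_coe_nnreal_ennreal.comp (hhd K τ))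
  rw [hcpl] at hB
  exact termRepr_of_withDensity (Ω := fun K τ => ΩA K τ × ΩF K τ) (ν := cpl μA fib) (hd := fun K τ z => hd K τ z.1) hB
    fun K τ => (hhd K τ).comp measurable_fst

end DensityCoupled

/-! ## §5 Sanity: both designs FIRE on the toy of `T4LipschitzLedger.Sanity` (one-point fibres, Dirac kernel)

PURPOSE: the constructors `termRepr_prodLift` (design (Π)) and `termRepr_fibre_of_cpl` (design (F)) elaborate on
non-trivial data — the ledger's own toy (one term per cutoff, one small-field slot of age `0`, runs `3/4` and
`3/4 + (1/2)^K/8`) with a one-point extra fibre; the fibre-integrated remainder of a remainder of the common coordinates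
is that remainder.  Nothing here is an estimate; nothing of Bałaban's is asserted. [folklore] -/

namespace Sanity

open T4LipschitzLedger.Sanity

/-- toy fibres: a point. [folklore] -/
abbrev ΩF : ℕ → Unit → Type := fun _ _ => Unit

/-- toy fibre kernels: the constant Dirac kernel (Markov). [folklore] -/
def fib : (K : ℕ) → (τ : Unit) → Kernel (Ω K τ) (ΩF K τ) := fun _ _ => Kernel.const _ (Measure.dirac ())

/-- the toy reference measures are s-finite (Dirac). [folklore] -/
instance sFinite_μ (K : ℕ) (τ : Unit) : SFinite (μ K τ) := by
  unfold μ; infer_instance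

/-- the toy fibre kernels are Markov. [folklore] -/
instance isMarkovKernel_fib (K : ℕ) (τ : Unit) : IsMarkovKernel (fib K τ) := by
  unfold fib; infer_instance

/-- DESIGN (Π) FIRES: run A of the ledger's toy, lifted to the coupled space `μ ⊗ₘ fib`, with the lift of run B's
variables as the other family. [folklore] -/
theorem termRepr_A_cpl : TermRepr 1 T A χ κ Lχ 0 n (cpl μ fib) m slot pol θ (liftU uA) (liftU uB) (liftR R) :=
  termRepr_prodLift termRepr_A fun K τ hτ i hi => (termRepr_B.meas K τ hτ i hi).1.comp measurable_fst

/-- DESIGN (F) FIRES: run B of the toy, read on the coupled space (by (Π)) and fibre-integrated back onto the common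
coordinates, is represented against `μ` with the fibre-integrated remainder. [folklore] -/
theorem termRepr_B_fibre : TermRepr 1 T B χ κ Lχ 0 n μ m slot pol θ uB uA (fibR fib (liftR R)) :=
  termRepr_fibre_of_cpl (termRepr_prodLift termRepr_B fun K τ hτ i hi => (termRepr_A.meas K τ hτ i hi).1.comp measurable_fst)
    (fun K τ hτ i hi => (termRepr_B.meas K τ hτ i hi).1) fun K τ hτ i hi => (termRepr_A.meas K τ hτ i hi).1

/-- … and that fibre-integrated remainder IS the toy remainder (a one-point Markov fibre integrates a constant to
itself). [folklore] -/
theorem fibR_liftR : fibR fib (liftR R) = R := by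
  funext K t τ v
  simp [fibR, liftR, fib, R]

/-- (F∞) of the toy lifts to the coupled space (`supClose_cpl_of_fst` fires). [folklore] -/
theorem supClose_cpl : SupClose T (cpl μ fib) m slot θ (liftU uA) (liftU uB) ρ :=
  supClose_cpl_of_fst supClose

/-- run A's sibling suppression of the toy holds verbatim on the coupled space (`siblingSuppression_prodLift` fires).
[folklore] -/
theorem siblingSuppression_A_cpl :
    SiblingSuppression 1 T A 0 n (sibW χ κ (cpl μ fib) m slot pol θ (liftU uA) (liftR R) ρ) S :=
  siblingSuppression_prodLift termRepr_A siblingSuppression_A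

end Sanity

/-! ## §6 The disintegration constructor: `fib` and `h_d` EXIST for any finite reference of run B whose
common-coordinate marginal is absolutely continuous (Mathlib `Measure.condKernel` + Radon–Nikodym) -/

section GenericDisintegration

variable {α β : Type*} [MeasurableSpace α] [MeasurableSpace β]

/-- The finite (`ℝ≥0`-valued) version of the Radon–Nikodym derivative `dρ/dν`. [folklore] -/
def rnNN (ρ ν : Measure α) : α → ℝ≥0 := fun a => (ρ.rnDeriv ν a).toNNReal

/-- `rnNN` is measurable. [folklore] -/
theorem measurable_rnNN (ρ ν : Measure α) : Measurable (rnNN ρ ν) :=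
  (Measure.measurable_rnDeriv ρ ν).ennreal_toNNReal

/-- For a finite `ρ ≪ ν` (`ν` σ-finite) the truncation to `ℝ≥0` loses nothing: `ν.withDensity (rnNN ρ ν) = ρ`
(`Measure.rnDeriv_lt_top`, `Measure.withDensity_rnDeriv_eq`). [folklore] -/
theorem withDensity_rnNN_eq (ρ ν : Measure α) [IsFiniteMeasure ρ] [SigmaFinite ν] (hac : ρ ≪ ν) :
    ν.withDensity (fun a => (rnNN ρ ν a : ℝ≥0∞)) = ρ := by
  have hae : (fun a => (rnNN ρ ν a : ℝ≥0∞)) =ᵐ[ν] ρ.rnDeriv ν := by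
    filter_upwards [Measure.rnDeriv_lt_top ρ ν] with a ha
    exact ENNReal.coe_toNNReal ha.ne
  rw [withDensity_congr_ae hae, Measure.withDensity_rnDeriv_eq ρ ν hac]

variable [StandardBorelSpace β] [Nonempty β]

/-- **DISINTEGRATION OVER A PRESCRIBED BASE.**  A finite measure `ρ` on `α × β` (standard Borel fibre) whose first
marginal is absolutely continuous w.r.t. a σ-finite `ν` IS `(ν.withDensity h) ⊗ₘ ρ.condKernel` with `h = rnNN ρ.fst ν`
(`Measure.disintegrate` + `withDensity_rnNN_eq`). [folklore] -/
theorem withDensity_compProd_condKernel (ρ : Measure (α × β)) [IsFiniteMeasure ρ] (ν : Measure α) [SigmaFinite ν]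
    (hac : ρ.fst ≪ ν) :
    ν.withDensity (fun a => (rnNN ρ.fst ν a : ℝ≥0∞)) ⊗ₘ ρ.condKernel = ρ := by
  rw [withDensity_rnNN_eq ρ.fst ν hac]
  exact ρ.disintegrate ρ.condKernel

end GenericDisintegration

section Disintegration

variable {ι : Type*} {ΩA ΩF : ℕ → ι → Type*} [∀ K τ, MeasurableSpace (ΩA K τ)] [∀ K τ, MeasurableSpace (ΩF K τ)]
  {l₀ : ℝ} {T : ℕ → Finset ι} {B : ℕ → ℝ → ι → ℝ} {χ : ℕ → ℝ → ℝ} {κ Lχ : ℕ → ℝ} {N : ℕ} {n : ℕ → ℕ}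
  {μA : (K : ℕ) → (τ : ι) → Measure (ΩA K τ)}
  {m : ℕ → ι → ℕ} {slot : ℕ → ι → ℕ → Σ _ : ℕ, ℕ} {pol : ℕ → ι → ℕ → Pol} {θ : ℕ → ι → ℕ → ℝ}
  {uB uZ : (K : ℕ) → (τ : ι) → ℕ → ΩA K τ × ΩF K τ → ℝ} {RB : (K : ℕ) → ℝ → (τ : ι) → ΩA K τ × ΩF K τ → ℝ}

/-- **ABSOLUTE CONTINUITY OF THE COARSE MARGINAL IS AUTOMATIC WHEN RUN B's REFERENCE ALREADY HAS THE FORM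
`(μ_A.withDensity h) ⊗ₘ κ`** with `κ` Markov (then `ρ.fst = μ_A.withDensity h ≪ μ_A`). [folklore] -/
theorem fst_cpl_withDensity_absolutelyContinuous [∀ K τ, SFinite (μA K τ)]
    (hd : (K : ℕ) → (τ : ι) → ΩA K τ → ℝ≥0∞)
    (fib : (K : ℕ) → (τ : ι) → Kernel (ΩA K τ) (ΩF K τ)) [∀ K τ, IsMarkovKernel (fib K τ)] (K : ℕ) (τ : ι) :
    (cpl (fun K τ => (μA K τ).withDensity (hd K τ)) fib K τ).fst ≪ μA K τ := by
  rw [Measure.fst, map_fst_compProd]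
  exact withDensity_absolutelyContinuous _ _

variable [∀ K τ, StandardBorelSpace (ΩF K τ)] [∀ K τ, Nonempty (ΩF K τ)]

/-- The fibre kernels of a family of finite references on `Ω_A × Ω_F`: the conditional kernels (`Measure.condKernel`,
Markov). [folklore] -/
abbrev fibOf (ρ : (K : ℕ) → (τ : ι) → Measure (ΩA K τ × ΩF K τ)) [∀ K τ, IsFiniteMeasure (ρ K τ)] :
    (K : ℕ) → (τ : ι) → Kernel (ΩA K τ) (ΩF K τ) :=
  fun K τ => (ρ K τ).condKernel

/-- The common-coordinate densities of a family of references on `Ω_A × Ω_F` relative to run A's references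
(`rnNN` of the first marginals). [folklore] -/
abbrev hdOf (ρ : (K : ℕ) → (τ : ι) → Measure (ΩA K τ × ΩF K τ)) (μA : (K : ℕ) → (τ : ι) → Measure (ΩA K τ)) :
    (K : ℕ) → (τ : ι) → ΩA K τ → ℝ≥0 :=
  fun K τ => rnNN (ρ K τ).fst (μA K τ)

/-- **THE DISINTEGRATION CONSTRUCTOR.**  Run B represented against ANY family of finite references `ρ K τ` on
`Ω_A × Ω_F` (standard Borel fibres) whose common-coordinate marginals are absolutely continuous w.r.t. run A's σ-finite
references is represented against `cpl μA (fibOf ρ)` — run A's reference ⊗ₘ the CONDITIONAL kernels — with the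
remainder multiplied by the common-coordinate density `hdOf ρ μA`; after this §2 / §3 apply (`cauchy_of_cpl`,
`termRepr_fibre_of_cpl`, `cauchy_of_fibre`).  So the fibre kernel and the density of THE DICTIONARY need not be built by
hand: they EXIST by disintegration; what has to be supplied is the product STRUCTURE of run B's configuration space
(common coordinates × finest field), finiteness, and the absolute continuity of the coarse marginal. [folklore] -/
theorem termRepr_cpl_of_disintegration [∀ K τ, SigmaFinite (μA K τ)]
    (ρ : (K : ℕ) → (τ : ι) → Measure (ΩA K τ × ΩF K τ)) [∀ K τ, IsFiniteMeasure (ρ K τ)]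
    (hac : ∀ K τ, (ρ K τ).fst ≪ μA K τ)
    (hB : TermRepr l₀ T B χ κ Lχ N n ρ m slot pol θ uB uZ RB) :
    TermRepr l₀ T B χ κ Lχ N n (cpl μA (fibOf ρ)) m slot pol θ uB uZ
      (fun K t τ z => (hdOf ρ μA K τ z.1 : ℝ) * RB K t τ z) := by
  have hρ : ρ = cpl (fun K τ => (μA K τ).withDensity fun v => (hdOf ρ μA K τ v : ℝ≥0∞)) (fibOf ρ) := by
    funext K τ
    exact (withDensity_compProd_condKernel (ρ K τ) (μA K τ) (hac K τ)).symm
  have hB' : TermRepr l₀ T B χ κ Lχ N n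
      (cpl (fun K τ => (μA K τ).withDensity fun v => (hdOf ρ μA K τ v : ℝ≥0∞)) (fibOf ρ)) m slot pol θ uB uZ RB := by
    rw [← hρ]; exact hB
  exact termRepr_cpl_of_commonDensity (fun K τ => measurable_rnNN _ _) hB'

end Disintegration

/-! ### §6 sanity: the constructor fires on the toy of §5 -/

namespace Sanity

open T4LipschitzLedger.Sanity

/-- The toy reference (a Dirac mass) is finite. [folklore] -/
instance isFiniteMeasure_μ (K : ℕ) (τ : Unit) : IsFiniteMeasure (μ K τ) := by
  unfold μ; infer_instance

/-- On the toy, run A's coupled representation of §5 disintegrates back over `μ`: the constructor of §6 FIRES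
(fibre `Unit` is standard Borel; the coarse marginal of `μ ⊗ₘ fib` is `μ` itself). [folklore] -/
theorem termRepr_A_disintegrated :
    TermRepr 1 T A χ κ Lχ 0 n (cpl μ (fibOf (cpl μ fib))) m slot pol θ (liftU uA) (liftU uB)
      (fun K t τ z => (hdOf (cpl μ fib) μ K τ z.1 : ℝ) * liftR R K t τ z) :=
  termRepr_cpl_of_disintegration (cpl μ fib)
    (fun K τ => by rw [Measure.fst, map_fst_compProd]) termRepr_A_cpl

end Sanity

end

end Literature.MathematicalPhysics.QuantumFieldTheory.Balaban1983to89.T4TermReprCoupling
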